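import Literature.AlgebraicGeometry.Frobenioids.ArchimedeanBasicPropertiesSchemaNegativeB
import Literature.AlgebraicGeometry.Frobenioids.ArchimedeanBasicPropertiesSchemaNegativeC
import Literature.AlgebraicGeometry.Frobenioids.ArchimedeanBasicPropertiesSchemaNegativeE
import HarnessLib

/-!
# Frobenioids II, Theorem 3.6 at `C^Λ`: the `Λ`-indexed INSTANCE statements `Thm36i_istr_all_C π pf rlf`,
# `Thm36v_C π pf rlf`, `Thm36iv_readings_CA π pf rlf`, `Thm36i_ampleTypes_C π pf rlf` over the completion
# INTERFACE (FACT-LIST F-0871, F-0881, F-0878, F-0868), and the schema `Thm36iii_factorization F radial`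
# (F-0784), have REFUTABLE universal closures — they are facts AT THE CONSTRUCTED DATA only

Mochizuki, *The geometry of Frobenioids II: poly-Frobenioids*, Kyushu J. Math. **62** (2008) 401–460,
§3, Example 3.3 (ii) p. 28 ("`C^ℤ := C`; `C^ℚ := C^pf`; `C^ℝ := C^rlf`") and Theorem 3.6 (i), (iii), (iv),
(v) pp. 36–37 [cite: MochizukiFrdII2008, Thm 3.6 pp.36-38].

Negative knowledge recorded next to `ArchimedeanTheoremsInstances.lean` (abc-iut-L1-t9), PROOF-ONLY (no
definition, no instance), abc-iut cell seat abc-iut-f-008 (block F, float; class `preparatory`,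
kernel_closedness `parametrised`).  Companion files for the generic schemata:
`ArchimedeanBasicPropertiesSchemaNegative{,B,C,D,E}.lean`.

WHY THESE ROWS ARE SCHEMATA.  The instance statements of `ArchimedeanTheoremsInstances.lean` quantify
`∀ Λ : MonoidType` over `archFrobenioid π pf rlf Λ`, where the completion data
`pf rlf : LambdaCompletion π` ("`C^pf`", "`C^rlf`") are a FREE INTERFACE — ANY category with ANY
pre-Frobenioid structure over `D` receiving a functor from `C` over `D` (seat t6's TODO-merge; the
instances file says so in its docstring).  THE data are `Thm36Sub.pfCompletion π hF` (the perfection,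
[FrdI] Def. 3.1 (iii)) and `Thm36Sub.rlfCompletion π` (the realification, [FrdI] Prop. 5.3), at which every
instance is PROVED (`Thm36SubInstancesA/B.lean`).  At OTHER data the `Λ ∈ {ℚ, ℝ}` conjuncts say nothing
about the paper and are false; the kernel objects used here, all over the identity base `𝟭 D₀`:

* the TRIVIAL datum `LambdaCompletion.self (𝟭 D₀)` ("`C^ℚ := C^ℤ`"): then the `Λ = ℚ` conjunct of
  `Thm36i_istr_all_C` is `Thm36i_istr_all (C → F_Φ) ℚ` (false: the slit object, part B
  `not_thm36i_istr_all_C_Q`) and the `Λ = ℚ` conjunct of `Thm36v_C` contains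
  `Thm36v_torsionFree (C → F_Φ) ℚ` (false: `O^×(complex isotropic) ≅ S¹` has torsion, part C
  `not_thm36v_torsionFree_C_Q`);
* the ZERO-SECTION datum `(D₀, Φ, D₀ → F_Φ, C → D₀)` ([FrdI] Prop. 1.5 `ElemFrobenioid.zeroSection`; the
  functor `C → D₀` is the base functor, which lies over `D₀` on the nose): with `Φ := Φ₀` the `Λ = ℚ`
  conjunct of `Thm36iv_readings_CA` contains `Thm36iv_faithful_of_isIsotropic (D₀ → F_{Φ₀}) ℚ` (false:
  part E — at `Spec ℂ`, `O^▷ = O^× = {id}` but `conj ≠ id` under the faithful comparison functor); with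
  `Φ := ` the trivial monoid the `Λ = ℚ` conjunct of `Thm36i_ampleTypes_C` says "`D₀ → F_0` is NOT of
  group-like type" (false: every divisor monoid value is trivial);
* for the schema `Thm36iii_factorization F radial` (the radial predicate is a free binder): `radial := ⊥`
  admits no factorization of `id_A` at all.

Theorems: `not_forall_thm36i_istr_all_C`, `not_forall_thm36v_C`, `not_forall_thm36iv_readings_CA`,
`not_forall_thm36i_ampleTypes_C`, `not_forall_thm36iii_factorization` (¬ of the fully quantified closures,
universe level `0`), each from a named ¬-instance.

The INSTANCE forms at THE data / the printed claims are PROVED in the tree and are what consumers bind: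
F-0871 ⟶ `ArchFrd.Thm36Sub.thm36i_istr_all_C_holds` (+ `istrAll_Q_holds`, `istrAll_R_holds`); F-0881 ⟶
`ArchFrd.Thm36Sub.thm36v_C_holds` (+ `UnitStab.thm36v_*_C`, `v_Q_holds`, `v_R_holds`); F-0878 ⟶
`ArchFrd.Thm36Sub.thm36iv_readings_CA_holds` / `thm36iv_readings_CA_pfCompletion` (+ `ivReadings_R_holds`,
`ArchimedeanAutActionReadings.lean`); F-0868 ⟶ `ArchFrd.Thm36Sub.thm36i_ampleTypes_C_holds` (+
`thm36i_ampleTypes_C`, `thm36i_ampleTypes_CZ`, `Thm36SubAmpleTypesQ.lean`); F-0784 ⟶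
`ArchFrd.thm36iii_factorization_C` (F-0875 ✓, `ArchimedeanIsometrization.lean`, at the printed radial
predicate `ArchFrd.radial`).  The hypothesis `hF : IsFrobenioid (C → F_Φ)` of THE perfection is
`ArchFrd.Ex33ii_isFrobenioid_holds` (F-1372 ✓).  So each row is admissible ONLY at the constructed data
(FACT-LIST class «universal-closure REFUTED; instance form PROVED»).  Nothing here bears on the disputed
[IUTchIII] Cor. 3.12 or takes a side; refuted-as-schema is a statement about OUR typing (the interface
binders), not about the paper.
-/

namespace Literature.AlgebraicGeometry.Frobenioids

namespace ArchFrd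

open CategoryTheory

/-! ### F-0871: `Thm36i_istr_all_C` -/

/-- **F-0871, universal closure false:** at the trivial completion data `pf := rlf := C` itself
(`LambdaCompletion.self`), the `Λ = ℚ` conjunct of `Thm36i_istr_all_C` reads "`C = C^ℤ` is of isotropic
type", refuted by the slit object (`not_thm36i_istr_all_C_Q`). [cite: MochizukiFrdII2008, Thm 3.6 (i) p.36] -/
theorem not_thm36i_istr_all_C_self :
    ¬ Thm36i_istr_all_C (𝟭 D0) (LambdaCompletion.self (𝟭 D0)) (LambdaCompletion.self (𝟭 D0)) :=
  fun h => not_thm36i_istr_all_C_Q (h MonoidType.Q)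

/-- **F-0871 as a schema is not a fact:** the closure of `ArchFrd.Thm36i_istr_all_C` over all bases and
all completion data (universe level `0`) is FALSE; at THE data it is
`ArchFrd.Thm36Sub.thm36i_istr_all_C_holds`. [cite: MochizukiFrdII2008, Thm 3.6 (i) p.36] -/
theorem not_forall_thm36i_istr_all_C :
    ¬ ∀ {D : Type} [Category.{0} D] (π : D ⥤ D0) (pf rlf : LambdaCompletion π),
        Thm36i_istr_all_C π pf rlf :=
  fun h => not_thm36i_istr_all_C_self (h _ _ _)

/-! ### F-0881: `Thm36v_C` -/

/-- **F-0881, universal closure false:** at `pf := rlf := C`, the `Λ = ℚ` conjunct of `Thm36v_C` contains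
`Thm36v_torsionFree (C → F_Φ) ℚ`, refuted at the complex isotropic tip-`1` object
(`not_thm36v_torsionFree_C_Q`). [cite: MochizukiFrdII2008, Thm 3.6 (v) p.37] -/
theorem not_thm36v_C_self :
    ¬ Thm36v_C (𝟭 D0) (LambdaCompletion.self (𝟭 D0)) (LambdaCompletion.self (𝟭 D0)) :=
  fun h => not_thm36v_torsionFree_C_Q (h MonoidType.Q).2.1

/-- **F-0881 as a schema is not a fact:** the closure of `ArchFrd.Thm36v_C` over all bases and completion
data (universe level `0`) is FALSE; at THE data it is `ArchFrd.Thm36Sub.thm36v_C_holds`.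
[cite: MochizukiFrdII2008, Thm 3.6 (v) p.37] -/
theorem not_forall_thm36v_C :
    ¬ ∀ {D : Type} [Category.{0} D] (π : D ⥤ D0) (pf rlf : LambdaCompletion π), Thm36v_C π pf rlf :=
  fun h => not_thm36v_C_self (h _ _ _)

/-! ### F-0878: `Thm36iv_readings_CA` -/

/-- The part-E obstruction, read through the comparison functor `baseRC (𝟭 D₀) = 𝟭 ⋙ (D₀ → ArchBase)`
and at the label `Λ := ℚ`: for the zero section `D₀ → F_{Φ₀}`, complex conjugation and the identity of
`Spec ℂ` act identically on `O^▷ = O^× = {id}` but have different images.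
[cite: MochizukiFrdII2008, Thm 3.6 (iv) p.37] -/
theorem not_thm36iv_faithful_of_isIsotropic_zeroSection_Q :
    ¬ Thm36iv_faithful_of_isIsotropic (baseRC (𝟭 D0)) (ElemFrobenioid.zeroSection Φ₀) MonoidType.Q := by
  intro h
  let α : D0.complex ≅ D0.complex :=
    ⟨D0.conj, D0.conj, SchemaNegE.conj_comp_conj', SchemaNegE.conj_comp_conj'⟩
  have key := h (by decide) D0.complex (SchemaNegE.isIsotropic_zeroSection _) α (Iso.refl _)
    (SchemaNegE.conj_act_endSubmonoid α (Iso.refl _)) (SchemaNegE.conj_act_unitsSubgroup α (Iso.refl _))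
  have h' := congrArg Iso.hom key
  change D0.toArchBase.map D0.conj = D0.toArchBase.map (𝟙 D0.complex) at h'
  haveI := D0.toArchBase_faithful
  exact D0.conj_ne_id (D0.toArchBase.map_injective h')

/-- **F-0878, universal closure false:** at the ZERO-SECTION completion datum
`pf := (D₀, Φ₀, D₀ → F_{Φ₀}, C → D₀)` the `Λ = ℚ` conjunct of `Thm36iv_readings_CA` contains
`Thm36iv_faithful_of_isIsotropic (baseRC) (D₀ → F_{Φ₀}) ℚ`, which fails at `Spec ℂ`.
[cite: MochizukiFrdII2008, Thm 3.6 (iv) p.37] -/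
theorem not_thm36iv_readings_CA_zeroSectionDatum :
    ¬ Thm36iv_readings_CA (𝟭 D0)
        { cat := D0, monoid := Φ₀, str := ElemFrobenioid.zeroSection Φ₀, fromC := C.toBase (𝟭 D0),
          over := rfl }
        (LambdaCompletion.self (𝟭 D0)) :=
  fun h => not_thm36iv_faithful_of_isIsotropic_zeroSection_Q (h.1 MonoidType.Q).1

/-- **F-0878 as a schema is not a fact:** the closure of `ArchFrd.Thm36iv_readings_CA` over all bases and
completion data (universe level `0`) is FALSE; at THE data it is
`ArchFrd.Thm36Sub.thm36iv_readings_CA_holds`. [cite: MochizukiFrdII2008, Thm 3.6 (iv) p.37] -/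
theorem not_forall_thm36iv_readings_CA :
    ¬ ∀ {D : Type} [Category.{0} D] (π : D ⥤ D0) (pf rlf : LambdaCompletion π),
        Thm36iv_readings_CA π pf rlf :=
  fun h => not_thm36iv_readings_CA_zeroSectionDatum (h _ _ _)

/-! ### F-0868: `Thm36i_ampleTypes_C` -/

/-- **F-0868, universal closure false:** at the zero-section completion datum with TRIVIAL divisor monoid
`pf := (D₀, 0, D₀ → F_0, C → D₀)`, the `Λ = ℚ` conjunct of `Thm36i_ampleTypes_C` asserts that `D₀ → F_0`
is NOT of group-like type — but all its divisor monoids are trivial. [cite: MochizukiFrdII2008, Thm 3.6 (i) p.36] -/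
theorem not_thm36i_ampleTypes_C_zeroSectionDatum :
    ¬ Thm36i_ampleTypes_C (𝟭 D0)
        { cat := D0, monoid := (Functor.const _).obj (CommMonCat.of PUnit.{1}),
          str := ElemFrobenioid.zeroSection _, fromC := C.toBase (𝟭 D0), over := rfl }
        (LambdaCompletion.self (𝟭 D0)) := by
  intro h
  obtain ⟨-, -, -, -, hgl⟩ := h MonoidType.Q
  exact hgl fun _ _ => rfl

/-- **F-0868 as a schema is not a fact:** the closure of `ArchFrd.Thm36i_ampleTypes_C` over all bases and
completion data (universe level `0`) is FALSE; at THE data it is `ArchFrd.Thm36Sub.thm36i_ampleTypes_C_holds`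
(and `thm36i_ampleTypes_C` / `thm36i_ampleTypes_CZ` for `Λ = ℤ`). [cite: MochizukiFrdII2008, Thm 3.6 (i) p.36] -/
theorem not_forall_thm36i_ampleTypes_C :
    ¬ ∀ {D : Type} [Category.{0} D] (π : D ⥤ D0) (pf rlf : LambdaCompletion π),
        Thm36i_ampleTypes_C π pf rlf :=
  fun h => not_thm36i_ampleTypes_C_zeroSectionDatum (h _ _ _)

/-! ### F-0784: `Thm36iii_factorization` -/

/-- **F-0784, universal closure false:** the radial predicate of `Thm36iii_factorization F radial` is a free
binder; with `radial := ⊥` not even `id_A` factors (at the complex tip-`1` object of `C`).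
[cite: MochizukiFrdII2008, Thm 3.6 (iii) p.37] -/
theorem not_thm36iii_factorization_C_bot :
    ¬ Thm36iii_factorization (C.toElem (𝟭 D0)) (fun _ _ => False) := by
  intro h
  obtain ⟨p, ⟨-, -, hF, -⟩, -⟩ := h (𝟙 (unitObjOver (𝟭 D0) D0.complex))
  exact hF

/-- **F-0784 as a schema is not a fact:** the fully quantified closure of `ArchFrd.Thm36iii_factorization`
(over all structure functors and radial predicates, universe level `0`) is FALSE; the printed factorization
is the instance `ArchFrd.thm36iii_factorization_C` at `ArchFrd.radial` (F-0875).
[cite: MochizukiFrdII2008, Thm 3.6 (iii) p.37] -/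
theorem not_forall_thm36iii_factorization :
    ¬ ∀ {D : Type} [Category.{0} D] {Φ : Dᵒᵖ ⥤ CommMonCat.{0}} {X : Type} [Category.{0} X]
        (F : X ⥤ ElemFrobenioid Φ) (radial : ∀ A : X, (A ⟶ A) → Prop), Thm36iii_factorization F radial :=
  fun h => not_thm36iii_factorization_C_bot (h _ _)

end ArchFrd

end Literature.AlgebraicGeometry.Frobenioids
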